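import Literature.AlgebraicGeometry.PlaneCurves.HessePencilPointsOfOrderNine
import Literature.NumberTheory.EllipticCurves.PointsOfPrimeSquareOrder
import HarnessLib

/-!
# Each Halphen cubic `Bᵢ` cuts out one `Γ`-orbit — a coset of `E[3]`, nine points over `K̄` — of points of order `9` (Artebani–Dolgachev, proof of Prop. 5.2)

Topic `Literature/AlgebraicGeometry/PlaneCurves`, namespace `Literature.AlgebraicGeometry.PlaneCurves`.
Lane `lit-hodgefound`, seat `lit-hodgefound-p37`, row g21-#2 (FILE 2 of 2); the sequel of
`HessePencilPointsOfOrderNine` (Q2770: `hesse_B_eq_zero_iff` — `Bᵢ(N vec P) = 0 ↔ 3P + Tᵢ = O` for the eight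
non-zero `3`-torsion points `Tᵢ = aT₁ + bT₃`; `hesse_addOrderOf_eq_nine`) read through FILE 1
(`NumberTheory/EllipticCurves/PointsOfPrimeSquareOrder`: fibres of `[n]` are cosets of `E[n]`, have `n²` points
over `K̄`; `{ord = p²} = ⋃_{T ∈ E[p]∖0} [p]⁻¹T`; `72` points of order `9`).  Everything here is PROVED; no
definition, no named fact.

Source followed — M. Artebani, I. Dolgachev, *The Hesse pencil of plane cubic curves*, L'Enseignement Math. (2)
55 (2009) 235–273, §5, proof of Prop. 5.2 [arXiv:math/0611590, held `paper:arxiv-math_0611590` p0010 L51–L55],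
VERBATIM:

> The union of the eight cubics `Bᵢ` cuts out on each nonsingular member of the Hesse pencil the set of points of
> order 9 in the group law with the point `p₀` as the origin. […] *Proof.* Recall that the sections `E₁, …, E₈` on
> `S(3)′` are non-trivial 3-torsion sections (the zero section is equal to `E₀`). The preimage `B̄ᵢ` of `Eᵢ` under
> the map `r⁻¹ ∘ σ` cuts out on each nonsingular fibre the `Γ`-orbit of a point of order 9. Thus the image `Bᵢ` of
> `B̄ᵢ` in `ℙ²` is a plane cubic cutting out the `Γ`-orbit of a point of order 9 on each nonsingular member of the
> Hesse pencil.

## Dictionary (as in `HessePencilGroupLaw` / `HessePencilPointsOfOrderNine`)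

`K` a field with `3 ≠ 0`, `μ³ ≠ 1`, `ω² + ω + 1 = 0`; the member `H_μ = X³ + Y³ + Z³ − 3μXYZ` with its Weierstrass
model `W_μ` and the matrix `N_μ` (`H_μ ∘ N_μ = (μ³ − 1)·W_μ`, `N_μ O = p₀`); a point `P ∈ W_μ(K)` has the Hesse point
`N vec P` (`vec O = (0,1,0)`, `vec (x, y) = (x, y, 1)`); `T₁, T₃ ∈ W_μ(K)` are the points over `p₁ = (0, 1, −ω)`,
`p₃ = (1, 0, −1)`; "`Γ`" acts on `W_μ(K)` by the translations by `aT₁ + bT₃` (g20-#3), which lie in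
`W_μ(K)[3] = AddSubgroup.torsionBy _ 3`; "`Bᵢ ∩ E`" is the set `{P | Bᵢ(N vec P) = 0}`.

## What is here

* All eightfold statements are quantified over the printed list of pairs
  `(B₁, T₁), (B₅, 2T₁), (B₆, T₃), (B₂, 2T₃), (B₇, T₁ + T₃), (B₈, 2T₁ + T₃), (B₄, T₁ + 2T₃), (B₃, 2T₁ + 2T₃)`
  (`∀ BT ∈ [...], …` with `BT.1` the cubic and `BT.2` its `3`-torsion point, Q2770's `hesse_B_eq_zero_iff`).
* §1 (any such field) `hesse_torsion_pair_mem_torsionBy` (`aT₁ + bT₃ ∈ W_μ(K)[3]`); **`hesse_B_fibre_eq`** (the eight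
  sets `Bᵢ ∩ E` are the fibres of `[3]`: `{P | B₁(N vec P) = 0} = {P | 3P = −T₁}`, …, `{P | B₃(…) = 0} =
  {P | 3P = −(2T₁ + 2T₃)}`); **`hesse_B_translate`** ("the `Γ`-orbit": each `Bᵢ ∩ E` is stable under translation
  by every `R ∈ W_μ(K)[3]`, in particular by `Γ`); **`hesse_B_fibre_eq_coset`** (if `P₀ ∈ Bᵢ ∩ E` then
  `Bᵢ ∩ E = P₀ + W_μ(K)[3]` — ONE coset, i.e. one `Γ`-orbit as soon as `Γ·P₀ = P₀ + W_μ(K)[3]`, which is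
  `W_μ(K)[3] = {aT₁ + bT₃}`, the seat's g20-#5 over `K̄`); `hesse_setOf_addOrderOf_eq_nine` (the points of order `9`
  of `W_μ(K)` are the union of the fibres of `[3]` over the non-zero `3`-torsion points — FILE 1 at `p = 3`).
* §2 (`K` algebraically closed) **`hesse_B_fibre_ncard`** (each `Bᵢ ∩ E` has exactly `9 = #W_μ(K)[3]` points of
  `W_μ(K)`), `hesse_B_fibre_nonempty` ("a point of order 9" exists on each `Bᵢ`: with Q2770's
  `hesse_addOrderOf_eq_nine` every point of `Bᵢ ∩ E` has order `9`), **`hesse_ncard_addOrderOf_eq_nine`** (`W_μ(K̄)`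
  has exactly `72 = 8 · 9` points of order `9`).

NOT here: `W_μ(K̄)[3] = {aT₁ + bT₃}` and the pairwise distinctness of the nine `aT₁ + bT₃` (the seat's g20-#5
`HessePencilThreeTorsionBasis`, filed as p375833), hence neither "the eight `Bᵢ ∩ E` are pairwise disjoint" nor the
literal orbit equality `{P₀ + aT₁ + bT₃} = Bᵢ ∩ E` is restated; Bézout-type statements in `ℙ²` (the nine points as
`Bᵢ · H_μ = 9`); the surface `S(3)′` and the sections `Eᵢ`.

## References
* [ArtebaniDolgachev2009] M. Artebani, I. Dolgachev, *The Hesse pencil of plane cubic curves*, Enseign. Math. (2)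
  55 (2009) 235–273, §5, Prop. 5.2 and its proof.
* [SilvermanAEC2009] J. H. Silverman, *The Arithmetic of Elliptic Curves*, 2nd ed., GTM 106, Springer 2009,
  Cor. III.6.4 (b) (`#E[m] = m²`), Prop. III.4.2 (a).
-/

set_option autoImplicit false

open MvPolynomial Matrix
open Literature.NumberTheory.EllipticCurves

namespace Literature.AlgebraicGeometry.PlaneCurves

universe u

/-- The Weierstrass model `W_μ` of `H_μ` (local notation as in `HessePencilPointsOfOrderNine`). -/
local notation3 "𝐖[" μ "]" =>
  ({ a₁ := -μ, a₂ := -μ ^ 2, a₃ := (μ ^ 3 - 1) / 3, a₄ := μ * (μ ^ 3 - 1) / 3,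
     a₆ := -(μ ^ 3 - 1) ^ 2 / 27 } : WeierstrassCurve _)

/-- `N_μ = [[1, 0, 0], [−μ, 1, (μ³−1)/3], [0, −1, 0]]` (local notation). -/
local notation3 "𝐍[" μ "]" =>
  (Matrix.of ![![1, 0, 0], ![-μ, 1, (μ ^ 3 - 1) / 3], ![0, -1, 0]] : Matrix (Fin 3) (Fin 3) _)

/-- The eight cubics of Prop. 5.2, as printed (local notations as in `HessePencilEightCubics`). -/
local notation3 "𝐁₁[" ω "]" => (X 0 ^ 3 + C ω * X 1 ^ 3 + C (ω ^ 2) * X 2 ^ 3 : MvPolynomial (Fin 3) _)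
local notation3 "𝐁₅[" ω "]" => (X 0 ^ 3 + C (ω ^ 2) * X 1 ^ 3 + C ω * X 2 ^ 3 : MvPolynomial (Fin 3) _)
local notation3 "𝐁₂" => (X 0 ^ 2 * X 1 + X 1 ^ 2 * X 2 + X 2 ^ 2 * X 0 : MvPolynomial (Fin 3) _)
local notation3 "𝐁₆" => (X 0 ^ 2 * X 2 + X 1 ^ 2 * X 0 + X 2 ^ 2 * X 1 : MvPolynomial (Fin 3) _)
local notation3 "𝐁₃[" ω "]" =>
  (X 0 ^ 2 * X 1 + C (ω ^ 2) * (X 1 ^ 2 * X 2) + C ω * (X 2 ^ 2 * X 0) : MvPolynomial (Fin 3) _)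
local notation3 "𝐁₇[" ω "]" =>
  (X 0 ^ 2 * X 2 + C ω * (X 1 ^ 2 * X 0) + C (ω ^ 2) * (X 2 ^ 2 * X 1) : MvPolynomial (Fin 3) _)
local notation3 "𝐁₄[" ω "]" =>
  (X 0 ^ 2 * X 1 + C ω * (X 1 ^ 2 * X 2) + C (ω ^ 2) * (X 2 ^ 2 * X 0) : MvPolynomial (Fin 3) _)
local notation3 "𝐁₈[" ω "]" =>
  (X 0 ^ 2 * X 2 + C (ω ^ 2) * (X 1 ^ 2 * X 0) + C ω * (X 2 ^ 2 * X 1) : MvPolynomial (Fin 3) _)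

section AnyField

variable {K : Type u} [Field K] {μ : K} (vec : (𝐖[μ] : WeierstrassCurve K).toAffine.Point → Fin 3 → K)
variable {ω : K} {T₁ T₃ : (𝐖[μ] : WeierstrassCurve K).toAffine.Point} {c₁ c₃ : K}

/-! ## §1 The eight sets `Bᵢ ∩ E` as fibres of `[3]`; `Γ`-stability; one coset of `E[3]` -/

/-- From a dictionary `B(N vec P) = 0 ↔ 3P + T = O` to the fibre of `[3]` over `−T`. [folklore] -/
private theorem fibre_eq_of_dict [DecidableEq K] {B : MvPolynomial (Fin 3) K}
    {T : (𝐖[μ] : WeierstrassCurve K).toAffine.Point}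
    (hB : ∀ P : (𝐖[μ] : WeierstrassCurve K).toAffine.Point, eval ((𝐍[μ] : Matrix (Fin 3) (Fin 3) K) *ᵥ vec P) B = 0 ↔ 3 • P + T = 0) :
    {P : (𝐖[μ] : WeierstrassCurve K).toAffine.Point | eval ((𝐍[μ] : Matrix (Fin 3) (Fin 3) K) *ᵥ vec P) B = 0} =
      {P : (𝐖[μ] : WeierstrassCurve K).toAffine.Point | 3 • P = -T} := by
  ext P
  rw [Set.mem_setOf_eq, Set.mem_setOf_eq, hB, eq_neg_iff_add_eq_zero]

/-- From a dictionary to `W_μ(K)[3]`-stability of the zero set. [folklore] -/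
private theorem translate_of_dict [DecidableEq K] {B : MvPolynomial (Fin 3) K}
    {T : (𝐖[μ] : WeierstrassCurve K).toAffine.Point}
    (hB : ∀ P : (𝐖[μ] : WeierstrassCurve K).toAffine.Point, eval ((𝐍[μ] : Matrix (Fin 3) (Fin 3) K) *ᵥ vec P) B = 0 ↔ 3 • P + T = 0)
    {P R : (𝐖[μ] : WeierstrassCurve K).toAffine.Point} (hR : R ∈ AddSubgroup.torsionBy (𝐖[μ] : WeierstrassCurve K).toAffine.Point 3)
    (hP : eval ((𝐍[μ] : Matrix (Fin 3) (Fin 3) K) *ᵥ vec P) B = 0) : eval ((𝐍[μ] : Matrix (Fin 3) (Fin 3) K) *ᵥ vec (P + R)) B = 0 := by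
  have hR' : (3 : ℕ) • R = 0 := (AddSubgroup.torsionBy.nsmul_iff (n := 3)).1 hR
  rw [hB] at hP ⊢
  rw [smul_add, hR', add_zero]
  exact hP

/-- From a dictionary and one zero `P₀` to the coset `P₀ + W_μ(K)[3]`. [folklore] -/
private theorem coset_of_dict [DecidableEq K] {B : MvPolynomial (Fin 3) K}
    {T : (𝐖[μ] : WeierstrassCurve K).toAffine.Point}
    (hB : ∀ P : (𝐖[μ] : WeierstrassCurve K).toAffine.Point, eval ((𝐍[μ] : Matrix (Fin 3) (Fin 3) K) *ᵥ vec P) B = 0 ↔ 3 • P + T = 0)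
    {P₀ : (𝐖[μ] : WeierstrassCurve K).toAffine.Point} (h₀ : eval ((𝐍[μ] : Matrix (Fin 3) (Fin 3) K) *ᵥ vec P₀) B = 0) :
    {P : (𝐖[μ] : WeierstrassCurve K).toAffine.Point | eval ((𝐍[μ] : Matrix (Fin 3) (Fin 3) K) *ᵥ vec P) B = 0} =
      (fun R : (𝐖[μ] : WeierstrassCurve K).toAffine.Point => P₀ + R) '' (AddSubgroup.torsionBy (𝐖[μ] : WeierstrassCurve K).toAffine.Point 3 : Set (𝐖[μ] : WeierstrassCurve K).toAffine.Point) := by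
  rw [fibre_eq_of_dict vec hB]
  rw [hB, ← eq_neg_iff_add_eq_zero] at h₀
  exact setOf_nsmul_eq_eq_image h₀

/-- The eight dictionaries of Q2770 `hesse_B_eq_zero_iff` for the members of the printed list, paired with their
`3`-torsion points. [cite: ArtebaniDolgachev2009, §5 (Prop. 5.2 and its proof)] -/
private theorem dict_of_mem [DecidableEq K] (h3 : (3 : K) ≠ 0) (hμ : μ ^ 3 ≠ 1)
    (hω : ω ^ 2 + ω + 1 = 0) (hv0 : vec 0 = ![0, 1, 0])
    (hvs : ∀ x y (h : (𝐖[μ] : WeierstrassCurve K).toAffine.Nonsingular x y), vec (.some x y h) = ![x, y, 1])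
    (hc₁ : c₁ ≠ 0) (hT₁ : (𝐍[μ] : Matrix (Fin 3) (Fin 3) K) *ᵥ vec T₁ = c₁ • ![(0 : K), 1, -ω])
    (hc₃ : c₃ ≠ 0) (hT₃ : (𝐍[μ] : Matrix (Fin 3) (Fin 3) K) *ᵥ vec T₃ = c₃ • ![(1 : K), 0, -1])
    {B : MvPolynomial (Fin 3) K} {T : (𝐖[μ] : WeierstrassCurve K).toAffine.Point}
    (hBT : (B, T) ∈ ([(𝐁₁[ω], T₁), (𝐁₅[ω], 2 • T₁), (𝐁₆, T₃), (𝐁₂, 2 • T₃), (𝐁₇[ω], T₁ + T₃),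
        (𝐁₈[ω], 2 • T₁ + T₃), (𝐁₄[ω], T₁ + 2 • T₃), (𝐁₃[ω], 2 • T₁ + 2 • T₃)] :
        List (MvPolynomial (Fin 3) K × (𝐖[μ] : WeierstrassCurve K).toAffine.Point))) :
    ∀ P : (𝐖[μ] : WeierstrassCurve K).toAffine.Point, eval ((𝐍[μ] : Matrix (Fin 3) (Fin 3) K) *ᵥ vec P) B = 0 ↔ 3 • P + T = 0 := by
  intro P
  have d := hesse_B_eq_zero_iff vec h3 hμ hω hv0 hvs hc₁ hT₁ hc₃ hT₃ P
  simp only [List.mem_cons, List.not_mem_nil, or_false, Prod.mk.injEq] at hBT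
  rcases hBT with ⟨rfl, rfl⟩ | ⟨rfl, rfl⟩ | ⟨rfl, rfl⟩ | ⟨rfl, rfl⟩ | ⟨rfl, rfl⟩ | ⟨rfl, rfl⟩ | ⟨rfl, rfl⟩ |
    ⟨rfl, rfl⟩
  · exact d.1
  · exact d.2.1
  · exact d.2.2.1
  · exact d.2.2.2.1
  · exact d.2.2.2.2.1
  · exact d.2.2.2.2.2.1
  · exact d.2.2.2.2.2.2.1
  · exact d.2.2.2.2.2.2.2

/-- **`Γ` acts by `3`-torsion translations**: `aT₁ + bT₃ ∈ W_μ(K)[3]` for all `a, b` (g20-#3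
`three_nsmul_basePoints`). [cite: ArtebaniDolgachev2009, §4 ("`g₁` induces the translation by the 3-torsion point
`p₃` and `g₂` that by the point `p₁`")] -/
theorem hesse_torsion_pair_mem_torsionBy [DecidableEq K] (h3 : (3 : K) ≠ 0) (hμ : μ ^ 3 ≠ 1)
    (hω : ω ^ 2 + ω + 1 = 0) (hv0 : vec 0 = ![0, 1, 0])
    (hvs : ∀ x y (h : (𝐖[μ] : WeierstrassCurve K).toAffine.Nonsingular x y), vec (.some x y h) = ![x, y, 1])
    (hc₁ : c₁ ≠ 0) (hT₁ : (𝐍[μ] : Matrix (Fin 3) (Fin 3) K) *ᵥ vec T₁ = c₁ • ![(0 : K), 1, -ω])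
    (hc₃ : c₃ ≠ 0) (hT₃ : (𝐍[μ] : Matrix (Fin 3) (Fin 3) K) *ᵥ vec T₃ = c₃ • ![(1 : K), 0, -1]) (a b : ℕ) :
    a • T₁ + b • T₃ ∈ AddSubgroup.torsionBy (𝐖[μ] : WeierstrassCurve K).toAffine.Point 3 := by
  have h3ω : ω ^ 3 = 1 := by linear_combination (ω - 1) * hω
  exact (AddSubgroup.torsionBy.nsmul_iff (n := 3)).2
    (three_nsmul_basePoints vec h3 hμ h3ω hv0 hvs hc₁ hT₁ hc₃ hT₃ a b)

/-- **The eight sets `Bᵢ ∩ E` are fibres of multiplication by `3`**: for each of the eight pairs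
`(B₁, T₁)`, `(B₅, 2T₁)`, `(B₆, T₃)`, `(B₂, 2T₃)`, `(B₇, T₁ + T₃)`, `(B₈, 2T₁ + T₃)`, `(B₄, T₁ + 2T₃)`,
`(B₃, 2T₁ + 2T₃)`: `{P ∈ W_μ(K) | Bᵢ(N vec P) = 0} = {P | 3P = −Tᵢ}` — "the preimage `B̄ᵢ` of `Eᵢ` under the map
`r⁻¹ ∘ σ`" with `r = [3]`, read in the group of `W_μ` through Q2770's dictionary.
[cite: ArtebaniDolgachev2009, §5 (proof of Prop. 5.2)] -/
theorem hesse_B_fibre_eq [DecidableEq K] (h3 : (3 : K) ≠ 0) (hμ : μ ^ 3 ≠ 1)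
    (hω : ω ^ 2 + ω + 1 = 0) (hv0 : vec 0 = ![0, 1, 0])
    (hvs : ∀ x y (h : (𝐖[μ] : WeierstrassCurve K).toAffine.Nonsingular x y), vec (.some x y h) = ![x, y, 1])
    (hc₁ : c₁ ≠ 0) (hT₁ : (𝐍[μ] : Matrix (Fin 3) (Fin 3) K) *ᵥ vec T₁ = c₁ • ![(0 : K), 1, -ω])
    (hc₃ : c₃ ≠ 0) (hT₃ : (𝐍[μ] : Matrix (Fin 3) (Fin 3) K) *ᵥ vec T₃ = c₃ • ![(1 : K), 0, -1]) :
    ∀ BT ∈ ([(𝐁₁[ω], T₁), (𝐁₅[ω], 2 • T₁), (𝐁₆, T₃), (𝐁₂, 2 • T₃), (𝐁₇[ω], T₁ + T₃),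
        (𝐁₈[ω], 2 • T₁ + T₃), (𝐁₄[ω], T₁ + 2 • T₃), (𝐁₃[ω], 2 • T₁ + 2 • T₃)] :
        List (MvPolynomial (Fin 3) K × (𝐖[μ] : WeierstrassCurve K).toAffine.Point)),
      {P : (𝐖[μ] : WeierstrassCurve K).toAffine.Point | eval ((𝐍[μ] : Matrix (Fin 3) (Fin 3) K) *ᵥ vec P) BT.1 = 0} =
        {P : (𝐖[μ] : WeierstrassCurve K).toAffine.Point | 3 • P = -BT.2} := by
  rintro ⟨B, T⟩ hBT
  exact fibre_eq_of_dict vec (dict_of_mem vec h3 hμ hω hv0 hvs hc₁ hT₁ hc₃ hT₃ hBT)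

/-- **"the `Γ`-orbit": each `Bᵢ ∩ E` is stable under the translations by `W_μ(K)[3]`** — for every
`R ∈ W_μ(K)[3]` (in particular `R = aT₁ + bT₃`, `hesse_torsion_pair_mem_torsionBy`: the action of `Γ`), every
`P ∈ W_μ(K)` and each of the eight cubics `B`: `B(N vec P) = 0 → B(N vec (P + R)) = 0` (any field with `3 ≠ 0`,
`μ³ ≠ 1`). [cite: ArtebaniDolgachev2009, §5 (proof of Prop. 5.2: "cutting out the `Γ`-orbit of a point of order
9")] -/
theorem hesse_B_translate [DecidableEq K] (h3 : (3 : K) ≠ 0) (hμ : μ ^ 3 ≠ 1)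
    (hω : ω ^ 2 + ω + 1 = 0) (hv0 : vec 0 = ![0, 1, 0])
    (hvs : ∀ x y (h : (𝐖[μ] : WeierstrassCurve K).toAffine.Nonsingular x y), vec (.some x y h) = ![x, y, 1])
    (hc₁ : c₁ ≠ 0) (hT₁ : (𝐍[μ] : Matrix (Fin 3) (Fin 3) K) *ᵥ vec T₁ = c₁ • ![(0 : K), 1, -ω])
    (hc₃ : c₃ ≠ 0) (hT₃ : (𝐍[μ] : Matrix (Fin 3) (Fin 3) K) *ᵥ vec T₃ = c₃ • ![(1 : K), 0, -1])
    {R : (𝐖[μ] : WeierstrassCurve K).toAffine.Point} (hR : R ∈ AddSubgroup.torsionBy (𝐖[μ] : WeierstrassCurve K).toAffine.Point 3)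
    (P : (𝐖[μ] : WeierstrassCurve K).toAffine.Point) :
    ∀ BT ∈ ([(𝐁₁[ω], T₁), (𝐁₅[ω], 2 • T₁), (𝐁₆, T₃), (𝐁₂, 2 • T₃), (𝐁₇[ω], T₁ + T₃),
        (𝐁₈[ω], 2 • T₁ + T₃), (𝐁₄[ω], T₁ + 2 • T₃), (𝐁₃[ω], 2 • T₁ + 2 • T₃)] :
        List (MvPolynomial (Fin 3) K × (𝐖[μ] : WeierstrassCurve K).toAffine.Point)),
      eval ((𝐍[μ] : Matrix (Fin 3) (Fin 3) K) *ᵥ vec P) BT.1 = 0 →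
        eval ((𝐍[μ] : Matrix (Fin 3) (Fin 3) K) *ᵥ vec (P + R)) BT.1 = 0 := by
  rintro ⟨B, T⟩ hBT
  exact translate_of_dict vec (dict_of_mem vec h3 hμ hω hv0 hvs hc₁ hT₁ hc₃ hT₃ hBT) hR

/-- **Each `Bᵢ ∩ E` is ONE coset of `E[3]`**: if `P₀ ∈ W_μ(K)` lies on one of the eight cubics `B`
(`B(N vec P₀) = 0`) then `{P | B(N vec P) = 0} = P₀ + W_μ(K)[3]` — "the `Γ`-orbit of a point": with
`W_μ(K̄)[3] = {aT₁ + bT₃}` (the seat's g20-#5) this coset is the orbit `{P₀ + aT₁ + bT₃}` of `Γ`.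
[cite: ArtebaniDolgachev2009, §5 (proof of Prop. 5.2: "a plane cubic cutting out the `Γ`-orbit of a point of
order 9 on each nonsingular member")] -/
theorem hesse_B_fibre_eq_coset [DecidableEq K] (h3 : (3 : K) ≠ 0) (hμ : μ ^ 3 ≠ 1)
    (hω : ω ^ 2 + ω + 1 = 0) (hv0 : vec 0 = ![0, 1, 0])
    (hvs : ∀ x y (h : (𝐖[μ] : WeierstrassCurve K).toAffine.Nonsingular x y), vec (.some x y h) = ![x, y, 1])
    (hc₁ : c₁ ≠ 0) (hT₁ : (𝐍[μ] : Matrix (Fin 3) (Fin 3) K) *ᵥ vec T₁ = c₁ • ![(0 : K), 1, -ω])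
    (hc₃ : c₃ ≠ 0) (hT₃ : (𝐍[μ] : Matrix (Fin 3) (Fin 3) K) *ᵥ vec T₃ = c₃ • ![(1 : K), 0, -1])
    (P₀ : (𝐖[μ] : WeierstrassCurve K).toAffine.Point) :
    ∀ BT ∈ ([(𝐁₁[ω], T₁), (𝐁₅[ω], 2 • T₁), (𝐁₆, T₃), (𝐁₂, 2 • T₃), (𝐁₇[ω], T₁ + T₃),
        (𝐁₈[ω], 2 • T₁ + T₃), (𝐁₄[ω], T₁ + 2 • T₃), (𝐁₃[ω], 2 • T₁ + 2 • T₃)] :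
        List (MvPolynomial (Fin 3) K × (𝐖[μ] : WeierstrassCurve K).toAffine.Point)),
      eval ((𝐍[μ] : Matrix (Fin 3) (Fin 3) K) *ᵥ vec P₀) BT.1 = 0 →
        {P : (𝐖[μ] : WeierstrassCurve K).toAffine.Point | eval ((𝐍[μ] : Matrix (Fin 3) (Fin 3) K) *ᵥ vec P) BT.1 = 0} =
          (fun R : (𝐖[μ] : WeierstrassCurve K).toAffine.Point => P₀ + R) ''
            (AddSubgroup.torsionBy (𝐖[μ] : WeierstrassCurve K).toAffine.Point 3 : Set (𝐖[μ] : WeierstrassCurve K).toAffine.Point) := by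
  rintro ⟨B, T⟩ hBT h₀
  exact coset_of_dict vec (dict_of_mem vec h3 hμ hω hv0 hvs hc₁ hT₁ hc₃ hT₃ hBT) h₀

/-- **"the set of points of order `9`" is the union of the fibres of `[3]` over the non-zero `3`-torsion points**,
for `W_μ(K)` over any field (FILE 1 `setOf_addOrderOf_eq_prime_sq` at `p = 3`); over `K̄` these fibres are the
eight `Bᵢ ∩ E` of `hesse_B_fibre_eq` once `W_μ(K̄)[3] ∖ 0 = {−(aT₁ + bT₃) : (a, b) ≠ (0, 0)}` (the seat's g20-#5).
[cite: ArtebaniDolgachev2009, §5 (Prop. 5.2: "The union of the eight cubics `Bᵢ` cuts out … the set of points of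
order 9")] -/
theorem hesse_setOf_addOrderOf_eq_nine [DecidableEq K] (μ : K) :
    {P : (𝐖[μ] : WeierstrassCurve K).toAffine.Point | addOrderOf P = 9} =
      ⋃ T ∈ (AddSubgroup.torsionBy (𝐖[μ] : WeierstrassCurve K).toAffine.Point 3 : Set (𝐖[μ] : WeierstrassCurve K).toAffine.Point) \ {0},
        {P : (𝐖[μ] : WeierstrassCurve K).toAffine.Point | 3 • P = T} := by
  haveI : Fact (Nat.Prime 3) := ⟨Nat.prime_three⟩
  have h := setOf_addOrderOf_eq_prime_sq (A := (𝐖[μ] : WeierstrassCurve K).toAffine.Point) (p := 3)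
  norm_num at h
  exact h

end AnyField

section AlgClosed

open scoped Classical

variable {K : Type u} [Field K] [IsAlgClosed K] {μ : K}
  (vec : (𝐖[μ] : WeierstrassCurve K).toAffine.Point → Fin 3 → K)
variable {ω : K} {T₁ T₃ : (𝐖[μ] : WeierstrassCurve K).toAffine.Point} {c₁ c₃ : K}

/-! ## §2 Over an algebraically closed field: nine points on each `Bᵢ`, `72` points of order `9` -/

/-- **Each Halphen cubic meets `W_μ(K̄)` in exactly nine points of the group: `#{P | B(N vec P) = 0} = 9`** for
each of the eight cubics `B` (`K` algebraically closed, `3 ≠ 0`, `μ³ ≠ 1`) — the fibre of `[3]` over `−Tᵢ` is a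
coset of `W_μ(K)[3]`, non-empty because `[3]` is onto, and `#W_μ(K)[3] = 9` (FILE 1 `ncard_setOf_nsmul_eq_point`).
[cite: ArtebaniDolgachev2009, §5 (proof of Prop. 5.2: "the `Γ`-orbit of a point of order 9" — nine points)]
[cite: SilvermanAEC2009, Cor. III.6.4 (b)] -/
theorem hesse_B_fibre_ncard (h3 : (3 : K) ≠ 0) (hμ : μ ^ 3 ≠ 1)
    (hω : ω ^ 2 + ω + 1 = 0) (hv0 : vec 0 = ![0, 1, 0])
    (hvs : ∀ x y (h : (𝐖[μ] : WeierstrassCurve K).toAffine.Nonsingular x y), vec (.some x y h) = ![x, y, 1])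
    (hc₁ : c₁ ≠ 0) (hT₁ : (𝐍[μ] : Matrix (Fin 3) (Fin 3) K) *ᵥ vec T₁ = c₁ • ![(0 : K), 1, -ω])
    (hc₃ : c₃ ≠ 0) (hT₃ : (𝐍[μ] : Matrix (Fin 3) (Fin 3) K) *ᵥ vec T₃ = c₃ • ![(1 : K), 0, -1]) :
    ∀ BT ∈ ([(𝐁₁[ω], T₁), (𝐁₅[ω], 2 • T₁), (𝐁₆, T₃), (𝐁₂, 2 • T₃), (𝐁₇[ω], T₁ + T₃),
        (𝐁₈[ω], 2 • T₁ + T₃), (𝐁₄[ω], T₁ + 2 • T₃), (𝐁₃[ω], 2 • T₁ + 2 • T₃)] :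
        List (MvPolynomial (Fin 3) K × (𝐖[μ] : WeierstrassCurve K).toAffine.Point)),
      {P : (𝐖[μ] : WeierstrassCurve K).toAffine.Point | eval ((𝐍[μ] : Matrix (Fin 3) (Fin 3) K) *ᵥ vec P) BT.1 = 0}.ncard = 9 := by
  haveI : (𝐖[μ] : WeierstrassCurve K).IsElliptic := (hesse_weierstrass_isElliptic_iff h3 μ).2 hμ
  have h3' : ((3 : ℕ) : K) ≠ 0 := by exact_mod_cast h3
  rintro ⟨B, T⟩ hBT
  rw [hesse_B_fibre_eq vec h3 hμ hω hv0 hvs hc₁ hT₁ hc₃ hT₃ (B, T) hBT]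
  have h := ncard_setOf_nsmul_eq_point (𝐖[μ] : WeierstrassCurve K) h3' (-T)
  norm_num at h
  exact h

/-- **"a point of order `9`" exists on each `Bᵢ`**: over an algebraically closed field each of the eight sets
`{P | B(N vec P) = 0}` is non-empty (nine points, `hesse_B_fibre_ncard`; every one of them has order `9` by
Q2770's `hesse_addOrderOf_eq_nine`). [cite: ArtebaniDolgachev2009, §5 (proof of Prop. 5.2)] -/
theorem hesse_B_fibre_nonempty (h3 : (3 : K) ≠ 0) (hμ : μ ^ 3 ≠ 1)
    (hω : ω ^ 2 + ω + 1 = 0) (hv0 : vec 0 = ![0, 1, 0])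
    (hvs : ∀ x y (h : (𝐖[μ] : WeierstrassCurve K).toAffine.Nonsingular x y), vec (.some x y h) = ![x, y, 1])
    (hc₁ : c₁ ≠ 0) (hT₁ : (𝐍[μ] : Matrix (Fin 3) (Fin 3) K) *ᵥ vec T₁ = c₁ • ![(0 : K), 1, -ω])
    (hc₃ : c₃ ≠ 0) (hT₃ : (𝐍[μ] : Matrix (Fin 3) (Fin 3) K) *ᵥ vec T₃ = c₃ • ![(1 : K), 0, -1]) :
    ∀ BT ∈ ([(𝐁₁[ω], T₁), (𝐁₅[ω], 2 • T₁), (𝐁₆, T₃), (𝐁₂, 2 • T₃), (𝐁₇[ω], T₁ + T₃),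
        (𝐁₈[ω], 2 • T₁ + T₃), (𝐁₄[ω], T₁ + 2 • T₃), (𝐁₃[ω], 2 • T₁ + 2 • T₃)] :
        List (MvPolynomial (Fin 3) K × (𝐖[μ] : WeierstrassCurve K).toAffine.Point)),
      {P : (𝐖[μ] : WeierstrassCurve K).toAffine.Point | eval ((𝐍[μ] : Matrix (Fin 3) (Fin 3) K) *ᵥ vec P) BT.1 = 0}.Nonempty := by
  intro BT hBT
  exact Set.nonempty_of_ncard_ne_zero (by rw [hesse_B_fibre_ncard vec h3 hμ hω hv0 hvs hc₁ hT₁ hc₃ hT₃ BT hBT]; norm_num)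

/-- **`W_μ(K̄)` has exactly `72` points of order `9`** (`K` algebraically closed, `3 ≠ 0`, `μ³ ≠ 1`): eight cosets
of `W_μ(K)[3]` of nine points each — A–D's eight cubics `B₁, …, B₈` times "the `Γ`-orbit of a point of order 9"
(FILE 1 `ncard_setOf_addOrderOf_eq_nine`: `72 = #E[9] − #E[3] = 81 − 9`). [cite: ArtebaniDolgachev2009, §5
(Prop. 5.2)] [cite: SilvermanAEC2009, Cor. III.6.4 (b)] -/
theorem hesse_ncard_addOrderOf_eq_nine (h3 : (3 : K) ≠ 0) (hμ : μ ^ 3 ≠ 1) :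
    {P : (𝐖[μ] : WeierstrassCurve K).toAffine.Point | addOrderOf P = 9}.ncard = 72 := by
  haveI : (𝐖[μ] : WeierstrassCurve K).IsElliptic := (hesse_weierstrass_isElliptic_iff h3 μ).2 hμ
  exact ncard_setOf_addOrderOf_eq_nine (𝐖[μ] : WeierstrassCurve K) h3

end AlgClosed

end Literature.AlgebraicGeometry.PlaneCurves
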